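import Summits.PneNP.PneNP.Theses.SymmetryBudget
import Literature.Computability.Complexity.SymmetricCircuit
import Summits.PneNP.PneNP.Theorems.WindowHam.Negative.WindowHamFalseIff

/-!
# Crux-plan `zonal-compression-calibration` for crux stmt-PneNP-2143 `SymmetryBudget.WindowHam` —
# why NO skeleton is registered (the obstruction, kernel-checked)

Planner seat `planner-cruxplan-stmt-PneNP-2143-zonal-compression-ca-0`, 2026-08-16. This file is NOT a
line skeleton (no `stub_*`, no `WindowHam_of`); it is the checked core of the `no-skeleton` verdict in
`Lines/zonal-compression-calibration.md`.

The idea card's lever is an UPPER bound — Theorem A of `Cruxes/WindowHam/ZonalCompressionDerivation.md`: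
`sym-size_{Bud(m,g)}(HAM_m) ≤ 2^{c·g} · poly(m) · SIZE(Q)`, `Q ∈ NP` — whose consequence at `g = ⌊log₂ m⌋`
is `SymCompileHam` below (eventual polynomial-size GENERAL threshold circuits for HAM give eventual
polynomial-size WINDOW-SYMMETRIC ones; `Q ≤ₚ HAM` folded in). Together with Disproof F3 this calibrates the
crux: `WindowHam ↔ HamHardGeneral` (`calibration`). Hence (`concluding_iff_general`) for EVERY
proposition `S` — in particular for the conjunction of the stubs of any skeleton —
`(S → WindowHam) ↔ (S → HamHardGeneral)`: a skeleton concluding the crux by name is exactly a proof plan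
for the budget-0 general threshold-circuit lower bound for Hamiltonicity (≈ NP ⊄ P/poly), i.e. COSTUME in
the sense of the crux protocol. The two concrete cuts this rules out are spelled out in the line card
(C1: `stub_hamHardGeneral` + F3, compile stubs unused; C2: magnification at budget `⌊log₂ m⌋²`, whose
lower-bound stub must beat `2^{c·g}`, `c ≈ 7.6 > H(1/4) ≈ 0.81` = the support-theorem ceiling, and whose
composition factors through `HamHardGeneral` anyway).

Vocabulary: the landed `HasSymCircuit` / `pointStabiliserBudget` (Literature `SymmetricCircuit.lean`) and
the landed Negative-lane read-back `windowHam_iff_hasSymCircuit` (Theorems/WindowHam/Negative/WindowHamFalseIff,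
p74764). `HamHardGeneral` is re-declared verbatim from `Cruxes/WindowHam/Disproof.lean` (F3), which is a
work file and not assumed importable.
-/

set_option linter.dupNamespace false

namespace Summit.PneNP.PneNP.Cruxes.WindowHam.ZonalCompressionCalibration

open Literature.Computability.Complexity Filter
open Summit.PneNP.PneNP.Theses.SymmetryBudget (WindowHam)
open Summit.PneNP.PneNP.Theorems.WindowHam.Negative (windowHam_iff_hasSymCircuit)
open scoped Classical

/-- `HAM_m` as a Boolean function of the adjacency matrix (route convention: symmetrised, loops
dropped). Syntactically the `f` of every `HasSym` in the route file. -/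
noncomputable def HamFn (m : ℕ) : (Fin m × Fin m → Bool) → Bool :=
  fun x => decide (SimpleGraph.fromRel fun u v => x (u, v) = true).IsHamiltonian

/-- Eventual polynomial-size GENERAL (`tcBasis`, budget 0) circuits for HAM. -/
def HamEasyGeneral : Prop :=
  ∃ p : Polynomial ℕ, ∀ᶠ m in atTop,
    ∃ C : Circuit (Fin m × Fin m), C.IsOver tcBasis ∧ C.size ≤ p.eval m ∧ C.Computes (HamFn m)

/-- Eventual polynomial-size `Bud(m,⌊log₂ m⌋)`-SYMMETRIC circuits for HAM (the negation of the crux,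
cf. Disproof F2 `not_windowHam_iff`). -/
def HamEasyWindow : Prop :=
  ∃ q : Polynomial ℕ, ∀ᶠ m in atTop,
    HasSymCircuit tcBasis (pointStabiliserBudget m (Nat.log 2 m)) (q.eval m) (HamFn m)

/-- The plain threshold-circuit lower bound for HAM (Disproof F3 `HamHardGeneral`, verbatim):
for every polynomial `p`, infinitely often no `tcBasis`-circuit with `≤ p m` gates computes `HAM_m`.
Informally HAMCYCLE ∉ io-SIZE^{TC}(poly) — NP ⊄ P/poly strength. -/
def HamHardGeneral : Prop :=
  ∀ p : Polynomial ℕ, ∃ᶠ m in atTop,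
    ¬ ∃ C : Circuit (Fin m × Fin m), C.IsOver tcBasis ∧ C.size ≤ p.eval m ∧ C.Computes (HamFn m)

/-- The card's Theorem A at the window scale, in the only form the crux-2 calibration uses
(ideator's `SymCompileHam`; Cor. C (→) of the derivation): general easiness compiles into window-symmetric
easiness. This is what a prover of the card's content would establish (an M/L-sized theorem: run
decomposition, zonal support {λ₃ ≤ 1} from Macdonald VII.2 Ex. 2(c), Pieri realisation, closed subset
recursion with symmetric arithmetic, canonical interface + `Q ∈ NP`, and `Q ≤ₚ HAM`). Here it is a
HYPOTHESIS: the point of this file is what follows from it for skeleton-building, not its proof. -/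
def SymCompileHam : Prop := HamEasyGeneral → HamEasyWindow

theorem hamHardGeneral_iff_not_easy : HamHardGeneral ↔ ¬ HamEasyGeneral := by
  simp only [HamHardGeneral, HamEasyGeneral, not_exists, Filter.not_eventually]

theorem windowHam_iff_not_easyWindow : WindowHam ↔ ¬ HamEasyWindow := by
  rw [windowHam_iff_hasSymCircuit]
  simp only [HamEasyWindow, not_exists, Filter.not_eventually]
  exact Iff.rfl

/-- General circuits are budget-0 symmetric circuits, and budget 0 ≤ any budget: general easiness of
HAM is in particular NOT window easiness' obstacle — window easiness implies general easiness. -/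
theorem hamEasyGeneral_of_easyWindow (h : HamEasyWindow) : HamEasyGeneral := by
  obtain ⟨q, hq⟩ := h
  exact ⟨q, hq.mono fun m hm => by
    obtain ⟨C, hB, hs, -, hf⟩ := hm
    exact ⟨C, hB, hs, hf⟩⟩

/-- Disproof F3, re-derived over this file's vocabulary: the general lower bound implies the crux. -/
theorem windowHam_of_hamHardGeneral (h : HamHardGeneral) : WindowHam :=
  windowHam_iff_not_easyWindow.2 fun he =>
    hamHardGeneral_iff_not_easy.1 h (hamEasyGeneral_of_easyWindow he)

/-- Cor. C (→): modulo Theorem A the crux implies the general lower bound. -/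
theorem hamHardGeneral_of_windowHam (hA : SymCompileHam) (h : WindowHam) : HamHardGeneral :=
  hamHardGeneral_iff_not_easy.2 fun he => windowHam_iff_not_easyWindow.1 h (hA he)

/-- **Calibration** (card Cor. C): modulo Theorem A, `WindowHam ↔ HamHardGeneral`. -/
theorem calibration (hA : SymCompileHam) : WindowHam ↔ HamHardGeneral :=
  ⟨hamHardGeneral_of_windowHam hA, windowHam_of_hamHardGeneral⟩

/-- **No-skeleton lemma.** Modulo Theorem A, for every proposition `S` (read: the conjunction of the
stubs of a would-be skeleton), `S` proves the crux iff `S` proves the budget-0 general threshold-circuit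
lower bound for HAM. So every skeleton `WindowHam_of : stub₁ → … → stub_k → WindowHam` built on this card
is a proof plan for `HamHardGeneral` in costume; none is registered. -/
theorem concluding_iff_general (hA : SymCompileHam) (S : Prop) :
    (S → WindowHam) ↔ (S → HamHardGeneral) :=
  ⟨fun line s => hamHardGeneral_of_windowHam hA (line s),
    fun plan s => windowHam_of_hamHardGeneral (plan s)⟩

/-- The same for curried stub lists of the protocol's shape (two stubs shown; longer lists by
uncurrying): a two-stub line for the crux is a two-stub plan for `HamHardGeneral`. -/
theorem concluding_iff_general₂ (hA : SymCompileHam) (S₁ S₂ : Prop) :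
    (S₁ → S₂ → WindowHam) ↔ (S₁ → S₂ → HamHardGeneral) :=
  ⟨fun line s₁ s₂ => hamHardGeneral_of_windowHam hA (line s₁ s₂),
    fun plan s₁ s₂ => windowHam_of_hamHardGeneral (plan s₁ s₂)⟩

/-- Cut C1 of the line card, made explicit: the monotone cut's composition uses ONLY the general
lower bound — any compile stub `A` carried along is dead weight (shred), and the live stub is
`HamHardGeneral` itself (costume). -/
theorem cutC1_factors (A : Prop) : A → HamHardGeneral → WindowHam :=
  fun _ h => windowHam_of_hamHardGeneral h

/-! ## Cut C2 (magnification, card Cor. D) — it also factors through `HamHardGeneral`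

Theorem A with the budget FREE and the overhead explicit, over polynomial size bounds (all that the
crux-level statements see): compile exponent `c` (≈ 7.6 for the Gelfand-pair compile: orbit budget
`2^g · 3^g · 16^g · 2^g · g^{O(1)}`) and polynomial slack `a` (Karp reduction `Q ≤ₚ HAM`, string/matrix
encodings, symmetric arithmetic). The would-be lower-bound stub of the magnification cut must beat exactly
this overhead at some budget `g` (the card proposes `g = ⌊log₂ m⌋²`, where support theorems are available —
but only below `C(g, g/4) ≈ 2^{0.81 g}`, far under `2^{c g}`). The composition below shows the cut's stubs
prove `HamHardGeneral` first and the crux only through it (`windowHam_of_cutC2`): costume in substance. -/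

/-- Theorem A, budget-free form over polynomial size bounds: eventual general circuits of size `p n` for
`HAM_n` give, at EVERY budget function `g`, eventual `Bud(m, g m)`-symmetric circuits for `HAM_m` with
`≤ 2^(c·g m) · m^a · (p (m^a) + 1)` gates. (Hypothesis shape only; `ℕ`-polynomials are monotone, which is
why `p (m^a)` may stand in for `p` at the reduction's instance size.) -/
def ZonalCompileAt (c a : ℕ) : Prop :=
  ∀ p : Polynomial ℕ,
    (∀ᶠ n in atTop, ∃ C : Circuit (Fin n × Fin n), C.IsOver tcBasis ∧ C.size ≤ p.eval n ∧ C.Computes (HamFn n)) →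
    ∀ g : ℕ → ℕ, ∀ᶠ m in atTop,
      HasSymCircuit tcBasis (pointStabiliserBudget m (g m)) (2 ^ (c * g m) * (m ^ a * (p.eval (m ^ a) + 1)))
        (HamFn m)

/-- The lower-bound stub the magnification cut would need at budget `g`: symmetric size beyond the
compile overhead, infinitely often, for every polynomial. At `g = ⌊log₂ ·⌋²` and `c ≥ 1` this is a
`2^{c log² m}`-type bound — above the support-theorem ceiling `2^{0.81 g}`; no technique in print reaches it. -/
def SymLBBeyondCompile (c a : ℕ) (g : ℕ → ℕ) : Prop :=
  ∀ p : Polynomial ℕ, ∃ᶠ m in atTop,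
    ¬ HasSymCircuit tcBasis (pointStabiliserBudget m (g m)) (2 ^ (c * g m) * (m ^ a * (p.eval (m ^ a) + 1)))
        (HamFn m)

/-- Cut C2 composed: the two stubs prove the GENERAL lower bound directly (symmetric magnification). -/
theorem hamHardGeneral_of_cutC2 {c a : ℕ} {g : ℕ → ℕ} (hA : ZonalCompileAt c a)
    (hLB : SymLBBeyondCompile c a g) : HamHardGeneral :=
  hamHardGeneral_iff_not_easy.2 fun ⟨p, hp⟩ => by
    obtain ⟨m, hm, hm'⟩ := ((hLB p).and_eventually (hA p hp g)).exists
    exact hm hm'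

/-- … and the crux only THROUGH it (F3): registering `stub_compileAt`, `stub_symLBBeyondCompile` with this
`WindowHam_of` would file a proof plan for `HamHardGeneral` whose entire difficulty sits in one stub. -/
theorem windowHam_of_cutC2 {c a : ℕ} {g : ℕ → ℕ} (hA : ZonalCompileAt c a)
    (hLB : SymLBBeyondCompile c a g) : WindowHam :=
  windowHam_of_hamHardGeneral (hamHardGeneral_of_cutC2 hA hLB)

/-- Consistency of the two forms of Theorem A used here: the budget-free compile at `g = ⌊log₂ ·⌋`
gives `SymCompileHam` (the overhead `2^{c ⌊log₂ m⌋} · m^a · (p(m^a)+1) ≤ q(m)` for the polynomial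
`q = X^c · X^a · (p(X^a) + 1)`, since `2^{⌊log₂ m⌋} ≤ m`). -/
theorem symCompileHam_of_zonalCompileAt {c a : ℕ} (hA : ZonalCompileAt c a) : SymCompileHam := by
  rintro ⟨p, hp⟩
  refine ⟨Polynomial.X ^ c * (Polynomial.X ^ a * ((p.comp (Polynomial.X ^ a)) + 1)), ?_⟩
  refine ((hA p hp (Nat.log 2)).and (eventually_ge_atTop 1)).mono fun m hm => hm.1.mono ?_
  have hpos : m ≠ 0 := Nat.one_le_iff_ne_zero.1 hm.2
  have h2 : 2 ^ (c * Nat.log 2 m) ≤ m ^ c := by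
    rw [pow_mul']
    exact Nat.pow_le_pow_left (Nat.pow_log_le_self 2 hpos) c
  simpa [Polynomial.eval_mul, Polynomial.eval_pow, Polynomial.eval_X, Polynomial.eval_add,
    Polynomial.eval_one, Polynomial.eval_comp] using Nat.mul_le_mul_right _ h2

end Summit.PneNP.PneNP.Cruxes.WindowHam.ZonalCompressionCalibration
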